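import Summits.QuantumFields.YangMills.Theorems.UnitScaleTiltProp7TwistedSliceGaugeOntoTower
import Summits.QuantumFields.YangMills.Theorems.UnitScaleTiltProp7TowerClosenessOfRegPr
import HarnessLib

/-!
# Route `UnitScaleTilt`, crux K1 child «MinimiserStabilityRegPr» (stmt-QuantumFields-19200), skeleton v10, stub `stub_existenceMinimalOrbit` (EX), route (α) —
# **(P1) OF THE `hSplitD` ROW AT THE CHART POINT WITH NO TOWER-CLOSENESS DISPLAY**: ★w5-20520 g6's T5 B (✓`Prop7TwistedSliceGaugeOntoTower`) composed with the six rows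
# `hτ hν hν' hw hH hH'` supplied from `RegPr F n K ε₀ U₀` + `‖A₁‖ < e·η` + `U′(b) = e^{A₁(b)}U₀(b)` by ✓`Prop7TowerClosenessStairs` ∕ ✓`Prop7TowerClosenessOfRegPr` (this seat) at `δ := 1∕200`.

Cell `ym3-torus`, width seat `ym3-torus-px6` (gen 0).  THEOREMS ONLY (0 `def`, 0 `sorry`).  `--supports stmt-QuantumFields-19200 --as helper`, count-neutral.
YM₃ on T³ is a ladder rung (R3), not the Clay problem; nothing here claims the stub, the crux, d = 4 or the mass gap.

WHAT IS PROVED (sorry-free, no definition): ★★★`exists_gaugeParam_frameCorrected_eq_of_regPr` (T4's `hK` for every coarse target `m`, binders `hε₀ he hWe hWε U₀ U' hreg A₁ hA₁ hU' m` only);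
★★★`exists_slice_tangent_add_gaugeDir_of_QSym_eq_zero_of_regPr` ((P1): binders `hε₀ he hWe hWε hε₀' hε' U₀ U' hreg hreg' A₁ hA₁ hU' ξ hξ` — exactly T5 B's minus the closeness display).
HONEST SCOPE.  Two `exact`-compositions of landed theorems; (P2) and the 𝔰𝔲(2)-reality (★w4-20520 g6's ✓`…TwistedSliceGaugeOntoSU2(OfRegPr)`) are not treated; nothing of print is asserted.

References: T. Bałaban, CMP **98** (1985) 17–51 [Balaban1985Averaging] ((11) p.19, (58) p.27, (82) p.30, (97) p.32); CMP **99** (1985) 389–434 [Balaban1985BackgroundPropagators]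
((3.19) p.393, (3.21) p.394, (3.114)–(3.115) p.418); CMP **102** (1985) 277–309 [Balaban1985Variational] ((44)–(49) p.285, (82)–(83) p.290).
-/

set_option autoImplicit false

noncomputable section

open scoped BigOperators Topology Matrix.Norms.L2Operator
open Filter NormedSpace Metric

namespace Summit.QuantumFields.YangMills.Theorems.Prop7TowerClosenessOfRegPr

open Literature.MathematicalPhysics.QuantumFieldTheory.Balaban1983to89
open T4Continuum BlockAveraging ExpMeanLog MatrixLog
open T3ContinuumYM3Torus
open T3LevelShift (siteShift)
open T3PrintedRegularOrbits (sites_eq)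
open T3SectALandauChart (bgUnits eta eta_pos)
open T3PrintedRegularMinimiser (RegPr)
open B10Eq27TorusAxialLog (holT gaugeActT transl)
open B7Prop1Explicit (expUnit val_expUnit disp)
open Literature.Analysis.Calculus.ExpDifferential (ad gSer)
open Summit.QuantumFields.YangMills.Theorems.Prop8Chart (emlIterU)
open Summit.QuantumFields.YangMills.Theorems.Prop7SymAvgTwSym (tstairU vframeCovU frameAccU dbarCovIterU frameTwS logChartTwS)
open Summit.QuantumFields.YangMills.Theorems.Prop7SymAvgGL (QSym)
open B15DeterminingSets (embIter)
open Summit.QuantumFields.YangMills.Theorems.Prop7TwistedSliceGaugeOntoTower (exists_gaugeParam_frameCorrected_eq exists_slice_tangent_add_gaugeDir_of_QSym_eq_zero_of_tower)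

section Member

variable (F : T3Family) {n K : ℕ} (h : n ≤ K)

/-- ★★★ **T4's SOLVABILITY HYPOTHESIS `hK` AT A PRINTED-REGULAR BACKGROUND — NO CLOSENESS DISPLAY.**  ✓`Prop7TwistedSliceGaugeOntoTower.exists_gaugeParam_frameCorrected_eq` (T5 B) with
its six tower-closeness rows `hτ hν hν' hw hH hH'` DISCHARGED at `δ := 1∕200` by ✓`…TowerClosenessStairs` ∕ ✓`…TowerClosenessOfRegPr`: at `U₀ ∈ 𝔘_k(ε₀)` (`10¹²L³ε₀ ≤ 1`), chart point
`U′ = e^{A₁}U₀`, `‖A₁‖ < e·η` (`10⁹L²e ≤ 1`), for EVERY coarse target `m` there are a fine gauge parameter `N` and a chart velocity `γ` with `g(ad(−A₁(b)))γ(b) = N(b₋) − U′♭(b)N(b₊)U′♭(b)⁻¹`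
and `N(x̂_y) − D(v(·)(y))(A₁)γ·v(A₁)(y)⁻¹ = m(y)` at every comparison site. [cite: Balaban1985Averaging, (11) p.19, (58) p.27, (97) p.32; Balaban1985Variational, (44)-(49) p.285] -/
theorem exists_gaugeParam_frameCorrected_eq_of_regPr {ε₀ e : ℝ} (hε₀ : 0 < ε₀) (he : 0 < e) (hWe : 10 ^ 9 * (F.L : ℝ) ^ 2 * e ≤ 1) (hWε : 10 ^ 12 * (F.L : ℝ) ^ 3 * ε₀ ≤ 1)
    (U₀ U' : GaugeField (F.P K) 0 (Matrix.specialUnitaryGroup (Fin 2) ℂ)) (hreg : RegPr F n K ε₀ U₀)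
    (A₁ : PBond (F.P K) 0 → Matrix (Fin 2) (Fin 2) ℂ) (hA₁ : ‖A₁‖ < e * eta F n K)
    (hU' : ∀ b, ((U' b : Matrix.specialUnitaryGroup (Fin 2) ℂ) : Matrix (Fin 2) (Fin 2) ℂ) = exp (A₁ b) * ((U₀ b : Matrix.specialUnitaryGroup (Fin 2) ℂ) : Matrix (Fin 2) (Fin 2) ℂ))
    (m : Site (F.P n) 0 → Matrix (Fin 2) (Fin 2) ℂ) :
    ∃ (N : Site (F.P K) 0 → Matrix (Fin 2) (Fin 2) ℂ) (γ : PBond (F.P K) 0 → Matrix (Fin 2) (Fin 2) ℂ),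
      (∀ b, gSer ℂ (ad ℂ (-A₁ b)) (γ b) = N b.src - ((bgUnits F K U' b : (Matrix (Fin 2) (Fin 2) ℂ)ˣ) : Matrix (Fin 2) (Fin 2) ℂ) * N b.tgt *
          (((bgUnits F K U' b)⁻¹ : (Matrix (Fin 2) (Fin 2) ℂ)ˣ) : Matrix (Fin 2) (Fin 2) ℂ)) ∧
      ∀ y : Site (F.P n) 0, N (embIter (K - n) (siteShift (sites_eq F n K h) y))
          - fderiv ℂ (fun A : PBond (F.P K) 0 → Matrix (Fin 2) (Fin 2) ℂ => ((frameTwS F n K h U₀ A y : (Matrix (Fin 2) (Fin 2) ℂ)ˣ) : Matrix (Fin 2) (Fin 2) ℂ)) A₁ γ *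
              (((frameTwS F n K h U₀ A₁ y)⁻¹ : (Matrix (Fin 2) (Fin 2) ℂ)ˣ) : Matrix (Fin 2) (Fin 2) ℂ) = m y :=
  exists_gaugeParam_frameCorrected_eq F h hε₀ he hWe hWε U₀ U' hreg A₁ hA₁ hU' (δ := 1 / 200) (by norm_num) le_rfl
    (norm_tstairU_tower_sub_one_le_of_regPr F hε₀ he hWe hWε U₀ U' hreg A₁ hA₁ hU') (norm_frameAccU_le_two_of_regPr F hε₀ he hWe hWε U₀ U' hreg A₁ hA₁ hU')
    (norm_frameAccU_inv_le_two_of_regPr F hε₀ he hWe hWε U₀ U' hreg A₁ hA₁ hU') (norm_vframeCovU_inv_le_two_of_regPr F hε₀ he hWe hWε U₀ U' hreg A₁ hA₁ hU')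
    (norm_loopH_sub_one_le_of_regPr F hε₀ he hWe hWε U₀ U' hreg A₁ hA₁ hU') (norm_loopH_inv_sub_one_le_of_regPr F hε₀ he hWe hWε U₀ U' hreg A₁ hA₁ hU') m

/-- ★★★ **(P1) OF `hSplitD` AT THE CHART POINT FROM `RegPr` ALONE: `ker QSym(U′) ⊆ M·𝒯_{A₁} + 𝒢_{U′}`** — ✓`Prop7TwistedSliceGaugeOntoTower.exists_slice_tangent_add_gaugeDir_of_QSym_eq_zero_of_tower`
(T5 B) with its six tower-closeness rows DISCHARGED (`δ := 1∕200`): in the setting of T2 §5 (`U₀ ∈ 𝔘_k(ε₀)`, `U′ = e^{A₁}U₀ ∈ 𝔘_k(ε₀′)`, `10¹²L³ε₀ ≤ 1`, `10⁹L²e ≤ 1`, `10⁷L³ε₀′ ≤ 1`,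
`‖A₁‖ < e·η`) every `ξ ∈ ker QSym(U′)` splits as `ξ = Mβ + G_{U′}N` with `D(logChartTwS U₀)(A₁)β = 0`.  (`U′`'s regularity `hreg'` is T4's input, not the tower's.)  What remains of `hSplitD`:
(P2) (Landau transversality at the chart point) and the 𝔰𝔲(2) bookkeeping (★w4-20520 g6's ✓`…TwistedSliceGaugeOntoSU2`). [cite: Balaban1985Averaging, (11) p.19, (97) p.32;
Balaban1985BackgroundPropagators, (3.19) p.393, (3.114)-(3.115) p.418; Balaban1985Variational, (44)-(49) p.285, (82)-(83) p.290] -/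
theorem exists_slice_tangent_add_gaugeDir_of_QSym_eq_zero_of_regPr {ε₀ ε₀' e : ℝ} (hε₀ : 0 < ε₀) (he : 0 < e) (hWe : 10 ^ 9 * (F.L : ℝ) ^ 2 * e ≤ 1)
    (hWε : 10 ^ 12 * (F.L : ℝ) ^ 3 * ε₀ ≤ 1) (hε₀' : 0 < ε₀') (hε' : 10 ^ 7 * (F.L : ℝ) ^ 3 * ε₀' ≤ 1)
    (U₀ U' : GaugeField (F.P K) 0 (Matrix.specialUnitaryGroup (Fin 2) ℂ)) (hreg : RegPr F n K ε₀ U₀) (hreg' : RegPr F n K ε₀' U')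
    (A₁ : PBond (F.P K) 0 → Matrix (Fin 2) (Fin 2) ℂ) (hA₁ : ‖A₁‖ < e * eta F n K)
    (hU' : ∀ b, ((U' b : Matrix.specialUnitaryGroup (Fin 2) ℂ) : Matrix (Fin 2) (Fin 2) ℂ) = exp (A₁ b) * ((U₀ b : Matrix.specialUnitaryGroup (Fin 2) ℂ) : Matrix (Fin 2) (Fin 2) ℂ))
    (ξ : PBond (F.P K) 0 → Matrix (Fin 2) (Fin 2) ℂ) (hξ : QSym F n K h U' ξ = 0) :
    ∃ (β : PBond (F.P K) 0 → Matrix (Fin 2) (Fin 2) ℂ) (N : Site (F.P K) 0 → Matrix (Fin 2) (Fin 2) ℂ),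
      fderiv ℂ (logChartTwS F n K h U₀) A₁ β = 0 ∧
      ∀ b, ξ b = gSer ℂ (ad ℂ (-A₁ b)) (β b) + (N b.src - ((bgUnits F K U' b : (Matrix (Fin 2) (Fin 2) ℂ)ˣ) : Matrix (Fin 2) (Fin 2) ℂ) * N b.tgt *
          (((bgUnits F K U' b)⁻¹ : (Matrix (Fin 2) (Fin 2) ℂ)ˣ) : Matrix (Fin 2) (Fin 2) ℂ)) :=
  exists_slice_tangent_add_gaugeDir_of_QSym_eq_zero_of_tower F h hε₀ he hWe hWε hε₀' hε' U₀ U' hreg hreg' A₁ hA₁ hU' (δ := 1 / 200) (by norm_num) le_rfl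
    (norm_tstairU_tower_sub_one_le_of_regPr F hε₀ he hWe hWε U₀ U' hreg A₁ hA₁ hU') (norm_frameAccU_le_two_of_regPr F hε₀ he hWe hWε U₀ U' hreg A₁ hA₁ hU')
    (norm_frameAccU_inv_le_two_of_regPr F hε₀ he hWe hWε U₀ U' hreg A₁ hA₁ hU') (norm_vframeCovU_inv_le_two_of_regPr F hε₀ he hWe hWε U₀ U' hreg A₁ hA₁ hU')
    (norm_loopH_sub_one_le_of_regPr F hε₀ he hWe hWε U₀ U' hreg A₁ hA₁ hU') (norm_loopH_inv_sub_one_le_of_regPr F hε₀ he hWe hWε U₀ U' hreg A₁ hA₁ hU') ξ hξ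

end Member

end Summit.QuantumFields.YangMills.Theorems.Prop7TowerClosenessOfRegPr

end
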